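import Literature.MathematicalPhysics.QuantumFieldTheory.Balaban1983to89.Node00.Record13CoP
import Literature.MathematicalPhysics.QuantumFieldTheory.Balaban1983to89.Node00.LargeFieldBackgroundCoOfRecordFaces
import Summits.QuantumFields.YangMills.Theorems.BalabanUVNodesN11NoExpansionZetaSpec
import Literature.MathematicalPhysics.QuantumFieldTheory.Balaban1983to89.Node00.Record12LocalLawsTwoScale
import Literature.MathematicalPhysics.QuantumFieldTheory.Balaban1983to89.Node00.LargeFieldBackgroundCoPOfRecordFaces
import Literature.MathematicalPhysics.QuantumFieldTheory.Balaban1983to89.Node00.LargeFieldBackgroundCoPOfRecordFacesB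

/-!
EDITION (W2 item 45 of the FLAG №1 R2b cure, dag-n11-d g31): the locality component of the `ZetaSpecAt` witness goes through the funnel `LocalLaws.of_oneScale` (type-stable across T1′),
K0b's law is no longer consumed (`rfl`), and the two faces `regMSCoPOfRecord_one_eq_univ_of_Omega_empty` ∕ `UbgMSCoPOfRecord_one_of_Omega_empty` — vendored since into node00-def-R's
`Node00/LargeFieldBackgroundCoPOfRecordFaces` (:169 ∕ :211), now IMPORTED — are DROPPED here (the gate's `dedup.landed`; their readers resolve to the Node00 names).

# DAG node N11 — THE FIRST (S1ᵀ)₁₃ IDENTITY AT THE v1.5 `CoP` RECORD UNDER THE ζ-PIN: `BalabanUVNodesN11NoExpansionZetaSpec` (generic in the weight family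
# and the background) INSTANTIATED at 12a″'s weights `WtOfRecord₁₃P` and node00-def-R's support-edition background `UbgOfRecord₁₃CoP` — both F7 objects read
# by `TLaw₁₃CoP` (node00-def-T FILE 23 `Node00/Record13CoP`, director-ym LINES №160–№162)

Cell `pub-ymgap`, YM-PLAN Track A (HUMAN RULING D-0062), seat `pub-ymgap-dag-n11-d` (g7; R134 fan-out seat N11 [B14], strategy s2), route `BalabanUVNodes`
rev 19, item K1⁗ `StabilityBAtRecordR13Sep` = stmt-QuantumFields-20290 (helper, count-neutral; K1⁵ after KEY-20).  [III] = [Balaban1988Convergent].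

WHY THIS FILE.  FINDING №7 (this seat's `not_tLaw₁₃_zero`: at 12a's weights the first 𝐓-step law is FALSE at every `θ`) was cured by F7 — 12a″
`tkWeightsOfRecordP` (p519608: `ζ := ζ0`, no regularity factor), def-R's FILE 22′ `LargeFieldBackgroundCoPOfRecord` (p519921: the (2.12) class posed on the
support `Ω₀ = hullD(Ω₁)` only), FILE 23 `Record13CoP` (`WtOfRecord₁₃P`, `UbgOfRecord₁₃CoP`, `TLaw₁₃CoP`).  The sibling file proved, for ANY weight family
and background, that the all-large-field conjunct of the 𝐓-image §2 form at `k = 0` HOLDS under the ζ-spec ∕ the pin `ζ0_0(T)(U,V₁) := w(s′)(U,Ū)`.  HERE the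
two F7 objects are shown to meet that file's structural hypotheses UNCONDITIONALLY: (i) at a length-1 sequence with `Ω₁ = ∅` the support-edition class is
EVERYTHING (`Ω₀ = hullD(∅) = ∅`: both (1.7)∕(1.9) clauses range over empty sets — print p. 243 «including all large field regions»), so def-R's background
`U_1(s′)(𝐖) = 𝐖 0` for EVERY retained configuration (no class hypothesis — the located delta against the `T_η`-editions, which demanded global scale-0
regularity and sent rough data to the junk unit branch); (ii) `WtOfRecord₁₃P`'s generation-0 factor is `ζ0_0(T)·e^{−½quad_0(∅)}` (`rfl` + `χ(∅,∅) = 1`).  Hence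
★ `slotsT_one_ae_eq_sect2Slot_CoP_of_zeta0_pin`: under the pin, the first identity `slotT_1(s′) = 𝐓_1(s′)e^{A_1(s′)}` of `TLaw₁₃CoP θ p 0` holds `dV₁`-a.e.
for every term-value witness with `E_1(s′) = E(p)` — NO regularity letter, NO class hypothesis, NO `UminOfRecord` branch; and §2 packages the pin as an
honest residual datum (laws, locality, partition of unity PROVED) to certify that the conjunct FINDING №7 killed is now SATISFIABLE.  And (located) at K0b's
`ZtOfRecord` the factor is the constant `(#{Y})⁻¹`, so the spec there reads `(#{Y})⁻¹ = c·w(s′)(U,Ū)`.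

WHAT THIS FILE PROVES (0 `sorry`, 0 `def`, standard axioms; `N`-generic).  `regMSCoPOfRecord_one_eq_univ_of_Omega_empty`; `UbgMSCoPOfRecord_one_of_Omega_empty`
(generic def-R objects: ν, M, g, K, any `𝐖`); `UbgOfRecord₁₃CoP_one_pairCfg_of_Omega_empty` (the sibling's `hU` DISCHARGED at the record);
`WtOfRecord₁₃P_ζ_zero_univ` (`rfl`), `WtOfRecord₁₃P_w_zero_empty`; ★ `slotsT_one_ae_eq_sect2Slot_CoP_of_zeta0_pin`, `hasSect2FormAtZ_clause_one_CoP_of_zeta0_pin`;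
`zetaFactor_WtOfRecord₁₃P_of_Zt_eq_ZtOfRecord` (the factor at K0b's residual of record is the constant `(#{Y})⁻¹`).  §2 ★★ `exists_residual_clause_one_CoP`
(THE CURE CERTIFICATE: with 12a″'s weights and def-R's support-edition background THERE IS a residual on the run's torus obeying 12a's law, 12b's locality law
and print's partition of unity `Σᶠ_Y ζ0_j(Y) = 1` for which the first identity holds a.e. for every term-value witness — where at 12a's weights NO residual and
NO background could, `not_hasSect2FormTAEZ_zero`).

EDITION (Stage-2 train, WORKPLAN-IIIB (iii-b), director-ym №343 (D5)∕(D6), row TRAIN-N11, seat dag-n11-d g41): `UbgOfRecord₁₃CoP_one_pairCfg_of_Omega_empty` — which used the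
DEFINITIONAL unfolding of `UbgOfRecord₁₃CoP … 1` to node00-def-R's (b)-datum background — is re-proved SEAM-ROBUSTLY (`apply_rules` over `UbgMSCoPOfRecord_one_of_Omega_empty` and its S2c
print-datum twin `UbgMSCoPOfRecordB_one_of_Omega_empty`): statement byte-identical; it elaborates BEFORE and AFTER the `Record13CoP` seam edit (FLAG №16 ∕ LOCATE-HSEAM 5d3298b8d191f169).

HONEST FRAMING.  Count-neutral kernel bookkeeping on the tree's OWN objects; the SUFFICIENT half of (S1ᵀ)₁₃CoP's first instance at ONE new sequence under a
DISPLAYED pin on the witness's residual (K0a's pen decides whether to adopt it; the pin reads the run's thresholds while `θ.Zt K` is run-blind — located remark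
of the sibling file).  NOT `TLaw₁₃CoP θ p 0` (labels with `Ω₁ ≠ ∅` = [III] Thm 1 proper); NOT a decision at `ZtOfRecord` (the weaker conditional-expectation
identity is not decided here); nothing of Bałaban's asserted.  N11 NOT discharged; counts unmoved (typed 28∕28 · discharged 5∕28).  One finite four-torus
programme at fixed `ε = L^{−K}`; NOT ℝ⁴, NOT OS, NOT a mass gap, NOT Clay.  Sources: [III] p. 243, (1.11) p. 248, p. 255, (2.12)–(2.13) pp. 256–257, (2.17)–(2.18)
p. 257, (2.21)–(2.23) p. 258, (3.16) p. 268, (3.25) p. 270, Theorem p. 245, Thm 1 p. 262; [Balaban1985Variational] (2),(5)–(6) p. 278.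
-/

noncomputable section

open MeasureTheory
open scoped BigOperators Matrix.Norms.L2Operator

namespace Summit.QuantumFields.YangMills.Theorems.BalabanUVNodesN11NoExpansionZetaSpecAtCoP

open Literature.MathematicalPhysics.QuantumFieldTheory.Balaban1983to89 T4Continuum Node00 Node00.Tk DagBinding
open B15DeterminingSets
open BalabanUVNodesN11NoExpansionZetaSpec

variable {F : T4Family} {N : ℕ} [NeZero N]

/-! ## §1. AT THE v1.5 `CoP` RECORD (12a″'s weights `WtOfRecord₁₃P`, node00-def-R's support-edition background `UbgOfRecord₁₃CoP`): the first (S1ᵀ)₁₃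
identity `slotT_1(s′) = 𝐓_1(s′)e^{A_1(s′)}` of `TLaw₁₃CoP θ p 0` at the all-large-field new sequence, UNDER THE PIN — and what the pin's hypothesis reads
at K0b's `ZtOfRecord` -/

section AtCoP

variable (θ : Stage13Params F N) (p : B12.RunParams)



/-- **THE `CoP` BACKGROUND MAP OF RECORD AT LEVEL 1, ALL-LARGE-FIELD SEQUENCE, READS THE FINE FIELD AT EVERY TWO-SCALE CONFIGURATION** — §2's hypothesis
`hU`, DISCHARGED at the v1.5 record. [cite: Balaban1988Convergent, (1.11) p.248, (2.12) p.256, Thm 1 p.262] -/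
theorem UbgOfRecord₁₃CoP_one_pairCfg_of_Omega_empty (s : SeqOfRecord F θ.ν θ.τ9.M (gOfRecord₁₃ F N θ p) p.K 1) (hΩ : s.Ω 1 = ∅)
    (V1 : GaugeField (F.P p.K) 1 (SU N)) (Uf : GaugeField (F.P p.K) 0 (SU N)) :
    UbgOfRecord₁₃CoP F N θ p 1 s (fun j => (pairCfg (V := FluctV N) V1 Uf j).1) = Uf := by
  -- Stage-2 SEAM-ROBUST (WORKPLAN-IIIB, director-ym №343): `UbgOfRecord₁₃CoP … 1` is node00-def-R's (b)-datum background before the `Record13CoP` seam edit and the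
  -- print-datum background after it; both read the fine field at `Ω₁ = ∅` (`…_one_of_Omega_empty` and its S2c twin), so this proof elaborates in either state of the tree.
  have h : ∀ W : MSField (F.P p.K) (SU N), UbgOfRecord₁₃CoP F N θ p 1 s W = W 0 := fun W => by
    apply_rules only [hΩ, UbgMSCoPOfRecord_one_of_Omega_empty, UbgMSCoPOfRecordB_one_of_Omega_empty]
  rw [h]
  simp only [pairCfg_zero]

/-- The generation-0 `ζ` of the `CoP` weights of record on `T` IS the residual's `ζ0_0(T)` — NO regularity factor (12a″, `rfl`).
[cite: Balaban1988Convergent, (1.11) p.248, (2.21) p.258] -/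
theorem WtOfRecord₁₃P_ζ_zero_univ (ω : MultiCfg (F.P p.K) (SU N) (FluctV N)) :
    (WtOfRecord₁₃P F N θ p).ζ 0 Set.univ ω = (θ.Zt p.K).ζ0 0 Set.univ ω := rfl

/-- The generation-0 A-weight of the `CoP` weights of record at the empty regions is the Gaussian placeholder `e^{−½ quad_0(∅)}` (`χ(∅, ∅) = 1`).
[cite: Balaban1988Convergent, (2.21)–(2.22) p.258, (3.21) p.269] -/
theorem WtOfRecord₁₃P_w_zero_empty (ω : MultiCfg (F.P p.K) (SU N) (FluctV N)) :
    (WtOfRecord₁₃P F N θ p).w 0 ∅ ∅ ∅ ω = Real.exp (-(1 / 2 : ℝ) * (θ.Zt p.K).quad 0 ∅ ω) := by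
  show chiAW F N (FluctV N) θ.ν θ.A₁ p (gOfRecord₁₃ F N θ p) 0 ∅ ∅ ω * Real.exp (-(1 / 2 : ℝ) * (θ.Zt p.K).quad 0 ∅ ω) = _
  rw [chiAW_empty_empty, one_mul]

/-- **★ THE FIRST (S1ᵀ)₁₃ IDENTITY OF `TLaw₁₃CoP θ p 0` HOLDS UNDER THE PIN.**  At the v1.5 record — 12a″'s weights `WtOfRecord₁₃P θ p`, def-R's
support-edition background `UbgOfRecord₁₃CoP θ p 1` — and at the all-large-field new sequence `s′` (`Ω₁(s′) = ∅`): if the tuple's residual is PINNED at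
generation 0 on `T` by def-T's resummed step weight on the averaging graph, `(θ.Zt K).ζ0 0 T (U, V₁) = w(s′)(U, Ū)`, with `quad_0(∅) = 0` there, then for EVERY
term-value witness `t` the (3.25) identity `slotT_1(s′)(V₁) = 𝐓_1(s′)e^{A_1(s′)}(V₁)` holds `dV₁`-a.e. with the constant `E_1(s′) = E(p)` (hypotheses: unity of
the residual `ζ` of def-T's labels, the displayed joint measurability of `w(s′)`, `0 < K`, `1 ≤ M`; NO regularity letter, NO class hypothesis — both gone with F7).
[cite: Balaban1988Convergent, Theorem p.245, (3.25) p.270, (1.11) p.248, (2.18) p.257, (2.21)–(2.23) p.258, Thm 1 p.262] -/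
theorem slotsT_one_ae_eq_sect2Slot_CoP_of_zeta0_pin (hK : 0 < p.K) (hM : 1 ≤ θ.τ9.M) (hζu : IsZetaUnity F N θ.ν θ.τ9.M θ.ζ)
    (s : SeqOfRecord F θ.ν θ.τ9.M (gOfRecord₁₃ F N θ p) p.K 1) (hΩ : s.Ω 1 = ∅)
    (t : Sect2.TermValues (F.P p.K) (MatA N) (FluctV N) θ.τ9.M)
    (hZ : ∀ (V1 : GaugeField (F.P p.K) 1 (SU N)) (Uf : GaugeField (F.P p.K) 0 (SU N)),
      (θ.Zt p.K).ζ0 0 Set.univ (pairCfg (V := FluctV N) V1 Uf) =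
        wOfRecord₉ F N θ.toStage9Params p (gOfRecord₁₃ F N θ p) 0 s Uf ((avOfRecord F N p.K 0).avg Uf))
    (hq : ∀ (V1 : GaugeField (F.P p.K) 1 (SU N)) (Uf : GaugeField (F.P p.K) 0 (SU N)), (θ.Zt p.K).quad 0 ∅ (pairCfg (V := FluctV N) V1 Uf) = 0)
    (hmw : Measurable fun z : GaugeField (F.P p.K) 1 (SU N) × GaugeField (F.P p.K) 0 (SU N) =>
      wOfRecord₉ F N θ.toStage9Params p (gOfRecord₁₃ F N θ p) 0 s z.2 z.1) :
    ∀ᵐ V1 ∂fieldMeasure (F.P p.K) 1 (SU N),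
      chiSeqOfRecord F N θ.ν θ.τ9.M (gOfRecord₁₃ F N θ p) p.K 1 s V1 ≠ 0 →
        slotsTOfRecord F N θ.ν θ.τ9 (EOfRecord₁₃ F N θ) (wOfRecord₉ F N θ.toStage9Params) θ.ppSel p
            (gOfRecord₁₃ F N θ p) 1 s V1 =
          sect2Slot F N (FluctV N) p.K (settingOfRecord₁₃ F N θ p) (θ.Rz p.K) (WtOfRecord₁₃P F N θ p) s t (EOfRecord₁₃ F N θ p)
            (UbgOfRecord₁₃CoP F N θ p 1 s) V1 :=
  slotsT_one_ae_eq_sect2Slot_of_zeta0_pin θ p hK hM hζu s hΩ (WtOfRecord₁₃P F N θ p) t (UbgOfRecord₁₃CoP F N θ p 1 s)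
    (UbgOfRecord₁₃CoP_one_pairCfg_of_Omega_empty θ p s hΩ) (θ.Zt p.K) (WtOfRecord₁₃P_ζ_zero_univ θ p) (WtOfRecord₁₃P_w_zero_empty θ p) hZ hq hmw

/-- **… HENCE THE DICHOTOMY CLAUSE OF `HasSect2FormAtZ` AT `s′` FOR THE `CoP` RECORD** — the conjunct `TLaw₁₃CoP θ p 0` (`tLaw₁₃CoP_iff`) asks of the
all-large-field new sequence, identity branch, for the witness `(t, E(p))`. [cite: Balaban1988Convergent, (2.17)–(2.18) p.257, (3.25) p.270, remark p.262] -/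
theorem hasSect2FormAtZ_clause_one_CoP_of_zeta0_pin (hK : 0 < p.K) (hM : 1 ≤ θ.τ9.M) (hζu : IsZetaUnity F N θ.ν θ.τ9.M θ.ζ)
    (s : SeqOfRecord F θ.ν θ.τ9.M (gOfRecord₁₃ F N θ p) p.K 1) (hΩ : s.Ω 1 = ∅)
    (t : Sect2.TermValues (F.P p.K) (MatA N) (FluctV N) θ.τ9.M)
    (hZ : ∀ (V1 : GaugeField (F.P p.K) 1 (SU N)) (Uf : GaugeField (F.P p.K) 0 (SU N)),
      (θ.Zt p.K).ζ0 0 Set.univ (pairCfg (V := FluctV N) V1 Uf) =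
        wOfRecord₉ F N θ.toStage9Params p (gOfRecord₁₃ F N θ p) 0 s Uf ((avOfRecord F N p.K 0).avg Uf))
    (hq : ∀ (V1 : GaugeField (F.P p.K) 1 (SU N)) (Uf : GaugeField (F.P p.K) 0 (SU N)), (θ.Zt p.K).quad 0 ∅ (pairCfg (V := FluctV N) V1 Uf) = 0)
    (hmw : Measurable fun z : GaugeField (F.P p.K) 1 (SU N) × GaugeField (F.P p.K) 0 (SU N) =>
      wOfRecord₉ F N θ.toStage9Params p (gOfRecord₁₃ F N θ p) 0 s z.2 z.1) :
    slotsTOfRecord F N θ.ν θ.τ9 (EOfRecord₁₃ F N θ) (wOfRecord₉ F N θ.toStage9Params) θ.ppSel p (gOfRecord₁₃ F N θ p) 1 s = 0 ∨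
      ∀ᵐ V1 ∂fieldMeasure (F.P p.K) 1 (SU N),
        chiSeqOfRecord F N θ.ν θ.τ9.M (gOfRecord₁₃ F N θ p) p.K 1 s V1 ≠ 0 →
          slotsTOfRecord F N θ.ν θ.τ9 (EOfRecord₁₃ F N θ) (wOfRecord₉ F N θ.toStage9Params) θ.ppSel p
              (gOfRecord₁₃ F N θ p) 1 s V1 =
            sect2Slot F N (FluctV N) p.K (settingOfRecord₁₃ F N θ p) (θ.Rz p.K) (WtOfRecord₁₃P F N θ p) s t (EOfRecord₁₃ F N θ p)
              (UbgOfRecord₁₃CoP F N θ p 1 s) V1 :=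
  Or.inr (slotsT_one_ae_eq_sect2Slot_CoP_of_zeta0_pin θ p hK hM hζu s hΩ t hZ hq hmw)

/-- **WHAT THE PIN'S HYPOTHESIS READS AT K0b's RESIDUAL OF RECORD** (located, kernel): at `θ.Zt = ZtOfRecord` the generation-0 factor of the `CoP` weights is
the CONSTANT `(#{Y})⁻¹` at every two-scale configuration (`ζ0 ≡ (#{Y})⁻¹`, `quad ≡ 0`) — so §2's spec `hζ` there is the equation
`(#{Y})⁻¹ = c·w(s′)(U, Ū)` for every fine field `U`: it holds only if def-T's resummed step weight is CONSTANT on the averaging graph.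
[cite: Balaban1988Convergent, (3.16) p.268, (3.2)–(3.3) p.265, (1.11) p.248] -/
theorem zetaFactor_WtOfRecord₁₃P_of_Zt_eq_ZtOfRecord (hZt : θ.Zt = ZtOfRecord F N)
    (V1 : GaugeField (F.P p.K) 1 (SU N)) (Uf : GaugeField (F.P p.K) 0 (SU N)) :
    (WtOfRecord₁₃P F N θ p).ζ 0 Set.univ (pairCfg (V := FluctV N) V1 Uf) * (WtOfRecord₁₃P F N θ p).w 0 ∅ ∅ ∅ (pairCfg (V := FluctV N) V1 Uf) =
      ((Nat.card (Set (Site (F.P p.K) 0)) : ℝ))⁻¹ := by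
  rw [WtOfRecord₁₃P_ζ_zero_univ, WtOfRecord₁₃P_w_zero_empty, hZt, ZtOfRecord_ζ0_apply, ZtOfRecord_quad_empty, mul_zero, Real.exp_zero, mul_one]


/-! ## §2. F7 CURES FINDING №7 AT THE FIRST INSTANCE: with 12a″'s weights and def-R's support-edition background the all-large-field conjunct is SATISFIABLE
by a residual obeying 12a's law, 12b's locality law and print's partition of unity — where with 12a's weights NO residual and NO background could
(this seat's `not_hasSect2FormTAEZ_zero`) -/

/-- **★★ THE CURE CERTIFICATE.**  At the all-large-field new sequence `s′` of a run `p` (`0 < K`, `1 ≤ M`; unity of def-T's residual `ζ`; the displayed joint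
measurability of `w(s′)`), THERE IS a residual 𝐓-weight datum `Z` on the torus `T_{L^{−K}}` — `ζ0_0(T)(ω) := w(s′)(U, Ū)`, `ζ0_0(∅)(ω) := 1 − w(s′)(U, Ū)`,
`ζ0_0(Y) := 0` otherwise (`U = (ω 0).1`), K0b's uniform factor at generations `j ≥ 1`, `quad := 0` — which OBEYS 12a's law `ζ0 ≥ 0`, 12b's locality law and
print's partition of unity `Σᶠ_Y ζ0_j(Y) = 1` at every generation, and for which the (3.25) identity `slotT_1(s′) = 𝐓_1(s′)e^{A_1(s′)}` of the 𝐓-image §2 form AT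
12a″'s WEIGHTS `tkWeightsOfRecordP … Z` and def-R's background `UbgOfRecord₁₃CoP θ p 1 s′` HOLDS `dV₁`-a.e., for EVERY term-value witness, with `E_1(s′) = E(p)`.
Contrast: at 12a's weights `tkWeightsOfRecord … Zt` the same conjunct is FALSE for EVERY residual `Zt` with these laws and EVERY background
(`BalabanUVNodesN11NoTLawAtAnyRegularity.not_hasSect2FormTAEZ_zero`, FINDING №7).  The datum reads the RUN (`w(s′)` carries `ε(g₀)`, `δ₀(g₀)`): it is a
residual ON THE TORUS OF THE RUN, not a run-blind `θ.Zt`. [cite: Balaban1988Convergent, (1.11) p.248, (3.16)–(3.20) pp.268–269, (3.25) p.270, Theorem p.245, (2.21) p.258] -/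
theorem exists_residual_clause_one_CoP (hK : 0 < p.K) (hM : 1 ≤ θ.τ9.M) (hζu : IsZetaUnity F N θ.ν θ.τ9.M θ.ζ)
    (s : SeqOfRecord F θ.ν θ.τ9.M (gOfRecord₁₃ F N θ p) p.K 1) (hΩ : s.Ω 1 = ∅)
    (hmw : Measurable fun z : GaugeField (F.P p.K) 1 (SU N) × GaugeField (F.P p.K) 0 (SU N) =>
      wOfRecord₉ F N θ.toStage9Params p (gOfRecord₁₃ F N θ p) 0 s z.2 z.1) :
    ∃ Z : TkResidualW F N (FluctV N) p.K,
      Z.Laws ∧ Z.LocalLaws ∧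
      (∀ (j : ℕ) (ω : MultiCfg (F.P p.K) (SU N) (FluctV N)), (∑ᶠ Y : Set (Site (F.P p.K) 0), Z.ζ0 j Y ω) = 1) ∧
      ∀ t : Sect2.TermValues (F.P p.K) (MatA N) (FluctV N) θ.τ9.M,
        ∀ᵐ V1 ∂fieldMeasure (F.P p.K) 1 (SU N),
          chiSeqOfRecord F N θ.ν θ.τ9.M (gOfRecord₁₃ F N θ p) p.K 1 s V1 ≠ 0 →
            slotsTOfRecord F N θ.ν θ.τ9 (EOfRecord₁₃ F N θ) (wOfRecord₉ F N θ.toStage9Params) θ.ppSel p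
                (gOfRecord₁₃ F N θ p) 1 s V1 =
              sect2Slot F N (FluctV N) p.K (settingOfRecord₁₃ F N θ p) (θ.Rz p.K)
                (tkWeightsOfRecordP F N (FluctV N) θ.ν θ.A₁ p (gOfRecord₁₃ F N θ p) Z) s t (EOfRecord₁₃ F N θ p)
                (UbgOfRecord₁₃CoP F N θ p 1 s) V1 := by
  classical
  -- the pin value, read at scale 0 on the averaging graph
  set a : MultiCfg (F.P p.K) (SU N) (FluctV N) → ℝ :=
    fun ω => wOfRecord₉ F N θ.toStage9Params p (gOfRecord₁₃ F N θ p) 0 s (ω 0).1 ((avOfRecord F N p.K 0).avg (ω 0).1) with ha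
  have ha0 : ∀ ω, 0 ≤ a ω := fun ω => stepWeightPin_nonneg θ p hζu s hΩ ω
  have ha1 : ∀ ω, a ω ≤ 1 := fun ω => stepWeightPin_le_one θ p hζu s hΩ ω
  have hne : (Set.univ : Set (Site (F.P p.K) 0)) ≠ ∅ :=
    Set.nonempty_iff_ne_empty.mp ⟨(fun _ => 0 : Fin (F.P p.K).d → ZMod ((F.P p.K).sitesPerDir 0)), Set.mem_univ _⟩
  -- the residual: the pin on `T`, its complement on `∅`, nothing elsewhere at generation 0; K0b's uniform factor above; `quad := 0`
  let ζf : ℕ → Set (Site (F.P p.K) 0) → MultiCfg (F.P p.K) (SU N) (FluctV N) → ℝ := fun j Y ω =>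
    if j = 0 then (if Y = Set.univ then a ω else if Y = ∅ then 1 - a ω else 0) else (ZtOfRecord F N p.K).ζ0 j Y ω
  have hζf0 : ∀ Y ω, ζf 0 Y ω = (if Y = Set.univ then a ω else if Y = ∅ then 1 - a ω else 0) := fun Y ω => if_pos rfl
  have hζfS : ∀ j Y ω, j ≠ 0 → ζf j Y ω = (ZtOfRecord F N p.K).ζ0 j Y ω := fun j Y ω hj => if_neg hj
  -- v1.1 (T0′ of the FLAG №1 R2b cure): the locality component goes through the funnel `LocalLaws.of_oneScale`
  refine ⟨⟨ζf, fun _ _ _ => 0⟩, ⟨fun j Y ω => ?_⟩, TkResidualW.LocalLaws.of_oneScale (fun j Y ω ω' h => ?_), fun j ω => ?_, fun t => ?_⟩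
  · -- 12a's law `ζ0 ≥ 0`
    show 0 ≤ ζf j Y ω
    by_cases hj : j = 0
    · subst hj
      rw [hζf0]
      split_ifs
      exacts [ha0 ω, sub_nonneg.mpr (ha1 ω), le_rfl]
    · rw [hζfS j Y ω hj]
      exact (ZtOfRecord_ζ0_pos F N p.K j Y ω).le
  · -- 12b's locality law: generation `0` reads `ω 0` only; K0b's factor reads nothing
    show ζf j Y ω = ζf j Y ω'
    by_cases hj : j = 0
    · subst hj
      have hωω : a ω = a ω' := by
        simp only [ha]
        rw [h]
      rw [hζf0, hζf0, hωω]
    · rw [hζfS j Y ω hj, hζfS j Y ω' hj]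
      rfl  -- K0b's uniform factor reads nothing (v1.1: no law of `ZtOfRecord` consumed)
  · -- print's partition of unity at every generation
    show (∑ᶠ Y : Set (Site (F.P p.K) 0), ζf j Y ω) = 1
    by_cases hj : j = 0
    · subst hj
      have hfun : (fun Y : Set (Site (F.P p.K) 0) => ζf 0 Y ω) =
          fun Y => if Y = Set.univ then a ω else if Y = ∅ then 1 - a ω else 0 := funext fun Y => hζf0 Y ω
      haveI : Fintype (Set (Site (F.P p.K) 0)) := Fintype.ofFinite _
      rw [hfun, finsum_eq_sum_of_fintype,
        Finset.sum_eq_add_of_mem (Set.univ : Set (Site (F.P p.K) 0)) ∅ (Finset.mem_univ _) (Finset.mem_univ _) hne]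
      · rw [if_pos rfl, if_neg (Ne.symm hne), if_pos rfl]
        ring
      · intro c _ hc
        rw [if_neg hc.1, if_neg hc.2]
    · have hfun : (fun Y : Set (Site (F.P p.K) 0) => ζf j Y ω) = fun Y => (ZtOfRecord F N p.K).ζ0 j Y ω :=
        funext fun Y => hζfS j Y ω hj
      rw [hfun]
      exact finsum_ζ0_ZtOfRecord F N p.K j ω
  · -- the identity, by the generic file's pin theorem at 12a″'s weights over this residual and def-R's support-edition background
    refine slotsT_one_ae_eq_sect2Slot_of_zeta0_pin θ p hK hM hζu s hΩ
      (tkWeightsOfRecordP F N (FluctV N) θ.ν θ.A₁ p (gOfRecord₁₃ F N θ p) ⟨ζf, fun _ _ _ => 0⟩) t (UbgOfRecord₁₃CoP F N θ p 1 s)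
      (UbgOfRecord₁₃CoP_one_pairCfg_of_Omega_empty θ p s hΩ) ⟨ζf, fun _ _ _ => 0⟩ (fun _ => rfl) (fun ω => ?_) (fun V1 Uf => ?_)
      (fun _ _ => rfl) hmw
    · show chiAW F N (FluctV N) θ.ν θ.A₁ p (gOfRecord₁₃ F N θ p) 0 ∅ ∅ ω * Real.exp (-(1 / 2 : ℝ) * 0) = Real.exp (-(1 / 2 : ℝ) * 0)
      rw [chiAW_empty_empty, one_mul]
    · show ζf 0 Set.univ (pairCfg (V := FluctV N) V1 Uf) = _
      rw [hζf0, if_pos rfl, ha]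
      simp only [pairCfg_zero]

end AtCoP

end Summit.QuantumFields.YangMills.Theorems.BalabanUVNodesN11NoExpansionZetaSpecAtCoP

end
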